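import HarnessLib
import Literature.NumberTheory.Automorphic.ReciprocityGLn
import Literature.NumberTheory.GaloisRepresentations.IntegralGaloisActionProofs
import Literature.NumberTheory.GaloisRepresentations.ArtinDirichletCoefficients

/-!
# `DedekindQuotientEntire` (stmt-Langlands-17271) — Negative knowledge: the small model `K = ℚ`
# is EXCLUDED by the Frobenius–splitting hypothesis (the binders are met only by quintic `K`)

Crux-disprover lemma (cdisprove, 2026-08-17) for the crux `DedekindQuotientEntire` of route
`DedekindQuotient1951`: `S4 → ∀ K RD ℓ ι π ρ, hfrob → IsLAlgebraic → Corresponds → (ζ_K/ζ holomorphic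
on Re s > 0)`, where `hfrob` says that at every finite `v` with `N v ∉ {1951, ℓ}` the representation
`ρ : Γ_ℚ → GL₄(ℚ̄_ℓ)` is unramified with Frobenius characteristic polynomial `Q_v` satisfying
`(X - 1)·Q_v = ∏_{𝔭 ∣ N v} (X^{f_𝔭} - 1)` in `𝓞 K`.  No `¬`-theorem of the crux is expected (its
conclusion is Dedekind's conjecture for `K`); this file fences the binders:

* `splittingRHS_rat` — at `K = ℚ` the right-hand side is `X - 1` at every rational prime
  (`(p) ⊂ 𝓞 ℚ` is prime, `factors_span_natCast_rat_toFinset`, of residue degree `1`,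
  `inertiaDeg_span_natCast_rat`, via Mathlib `Ideal.pow_inertiaDeg` and `absNorm (p) = p`);
* `frobHyp_false_rat` — hence `hfrob` is UNSATISFIABLE at `K = ℚ` for every `ℓ` and every
  `ρ : Γ_ℚ → GL₄(ℚ̄_ℓ)`: at `v = 2` (or `3` if `ℓ = 2`) it forces `Q_v = 1`, while `Q_v` is the
  characteristic polynomial of a `4 × 4` Frobenius matrix (a Frobenius above `v` exists,
  `exists_isArithFrobAt_of_mem_primesAbove_holds`), of degree `4`.
The same degree count at any unramified `p ∉ {1951, ℓ}` gives `Σ_{𝔭∣p} f_𝔭 = [K:ℚ] = 5` on paper: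
the crux quantifies effectively over QUINTIC fields unramified outside `{1951, ℓ}` — exactly where
Dedekind's conjecture is open (totally real `A₅`).  In particular `K = ℚ`, where the conclusion
holds trivially (`ζ_ℚ = ζ`), is NOT a non-vacuity witness of the implication.
No statement of the route is used or asserted. [folklore]
-/

set_option linter.dupNamespace false -- project-wide option (lakefile weak.linter.dupNamespace); `Summit.Langlands.Langlands` is the mandated namespace

noncomputable section

open scoped BigOperators Polynomial NumberField
open Polynomial IsDedekindDomain
open Literature.NumberTheory.GaloisRepresentations

namespace Summit.Langlands.Langlands.Theorems.DedekindQuotientEntire.Negative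

/-- `(p) ⊂ 𝓞 ℚ` is a prime element of the ideal monoid, for a rational prime `p`. [folklore] -/
theorem prime_span_natCast_rat {p : ℕ} (hp : p.Prime) :
    Prime (Ideal.span {((p : ℕ) : 𝓞 ℚ)}) := by
  have hprime : Prime ((p : ℕ) : 𝓞 ℚ) := by
    rw [← MulEquiv.prime_iff (Rat.ringOfIntegersEquiv : 𝓞 ℚ ≃+* ℤ)]
    simpa using Nat.prime_iff_prime_int.mp hp
  refine Ideal.prime_of_isPrime ?_ ((Ideal.span_singleton_prime hprime.ne_zero).mpr hprime)
  simpa [Ideal.span_singleton_eq_bot] using hprime.ne_zero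

/-- The distinct prime factors of `(p) ⊂ 𝓞 ℚ`: just `(p)` itself. [folklore] -/
theorem factors_span_natCast_rat_toFinset {p : ℕ} (hp : p.Prime) :
    (UniqueFactorizationMonoid.factors (Ideal.span {((p : ℕ) : 𝓞 ℚ)})).toFinset =
      {Ideal.span {((p : ℕ) : 𝓞 ℚ)}} := by
  classical
  rw [UniqueFactorizationMonoid.factors_eq_normalizedFactors,
    UniqueFactorizationMonoid.normalizedFactors_irreducible (prime_span_natCast_rat hp).irreducible,
    normalize_eq]
  rfl

/-- The residue degree of `(p) ⊂ 𝓞 ℚ` over `ℤ` is `1`. [folklore] -/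
theorem inertiaDeg_span_natCast_rat {p : ℕ} (hp : p.Prime) :
    (Ideal.span {((p : ℕ) : 𝓞 ℚ)}).inertiaDeg ℤ = 1 := by
  have hprime : Prime ((p : ℕ) : 𝓞 ℚ) := by
    rw [← MulEquiv.prime_iff (Rat.ringOfIntegersEquiv : 𝓞 ℚ ≃+* ℤ)]
    simpa using Nat.prime_iff_prime_int.mp hp
  haveI : (Ideal.span {((p : ℕ) : 𝓞 ℚ)}).IsPrime :=
    (Ideal.span_singleton_prime hprime.ne_zero).mpr hprime
  haveI : (Ideal.span {((p : ℕ) : 𝓞 ℚ)}).LiesOver (Ideal.span {(p : ℤ)}) := by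
    refine ⟨?_⟩
    have hbij : Function.Bijective (algebraMap ℤ (𝓞 ℚ)) :=
      ⟨Rat.int_algebraMap_injective (𝓞 ℚ), Rat.int_algebraMap_surjective (𝓞 ℚ)⟩
    have hmap : Ideal.span {((p : ℕ) : 𝓞 ℚ)} = (Ideal.span {(p : ℤ)}).map (algebraMap ℤ (𝓞 ℚ)) := by
      rw [Ideal.map_span, Set.image_singleton, map_natCast]
    rw [hmap, Ideal.under_def, Ideal.comap_map_of_bijective _ hbij]
  have h := Ideal.pow_inertiaDeg p (Ideal.span {((p : ℕ) : 𝓞 ℚ)})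
  have hnorm : Ideal.absNorm (Ideal.span {((p : ℕ) : 𝓞 ℚ)}) = p := by
    rw [Ideal.absNorm_span_singleton, show ((p : ℕ) : 𝓞 ℚ) = algebraMap ℤ (𝓞 ℚ) (p : ℤ) by simp,
      Algebra.norm_algebraMap, NumberField.RingOfIntegers.rank, Module.finrank_self]
    simp
  rw [hnorm] at h
  exact Nat.pow_right_injective hp.two_le (by simpa using h)

/-- The crux's splitting right-hand side at `K = ℚ` is `X - 1` at every rational prime. [folklore] -/
theorem splittingRHS_rat {p : ℕ} (hp : p.Prime) :
    ∏ 𝔭 ∈ (UniqueFactorizationMonoid.factors (Ideal.span {((p : ℕ) : 𝓞 ℚ)})).toFinset,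
        (X ^ (𝔭.inertiaDeg ℤ) - 1 : ℤ[X]) = X - 1 := by
  rw [factors_span_natCast_rat_toFinset hp, Finset.prod_singleton, inertiaDeg_span_natCast_rat hp,
    pow_one]

/-- **Small model `K = ℚ` is EXCLUDED by the Frobenius–splitting hypothesis of the crux**: for
`K = ℚ` the hypothesis forces `(X - 1)·Q_v = X - 1`, i.e. `Q_v = 1`, at some prime
`v ∉ {1951, ℓ}` (take `2` or `3`), but `Q_v` is the characteristic polynomial of a `4 × 4`
Frobenius matrix (a Frobenius exists: `exists_isArithFrobAt_of_mem_primesAbove_holds`), of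
degree `4 ≠ 0`.  (Same argument on paper at any unramified `p`: `deg = Σ_{𝔭∣p} f_𝔭 = [K:ℚ]`,
so the binders are met only by QUINTIC `K`.)  Hence `K = ℚ` — where the conclusion holds
(`ζ_ℚ = ζ`) — is not a non-vacuity witness of the implication. [folklore] -/
theorem frobHyp_false_rat {ℓ : ℕ} [Fact ℓ.Prime] (ρ : FramedGaloisRep ℚ (PadicAlgCl ℓ) 4) :
    ¬ ∀ v : HeightOneSpectrum (𝓞 ℚ), v.residueCard ≠ 1951 → v.residueCard ≠ ℓ →
      ρ.IsUnramifiedAt v ∧ ∃ Q : Polynomial (PadicAlgCl ℓ), ρ.HasFrobCharpolyAt v Q ∧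
        (X - C 1) * Q = (∏ 𝔭 ∈ (UniqueFactorizationMonoid.factors
          (Ideal.span {((v.residueCard : ℕ) : 𝓞 ℚ)})).toFinset,
            (X ^ (𝔭.inertiaDeg ℤ) - 1 : ℤ[X])).map (Int.castRingHom (PadicAlgCl ℓ)) := by
  intro h
  -- a rational prime `p ∉ {1951, ℓ}`
  obtain ⟨p, hp, hp1951, hpℓ⟩ : ∃ p : ℕ, p.Prime ∧ p ≠ 1951 ∧ p ≠ ℓ := by
    by_cases h2 : ℓ = 2
    · exact ⟨3, Nat.prime_three, by norm_num, by omega⟩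
    · exact ⟨2, Nat.prime_two, by norm_num, fun h => h2 h.symm⟩
  set v : HeightOneSpectrum (𝓞 ℚ) := (Rat.HeightOneSpectrum.primesEquiv (R := 𝓞 ℚ)).symm ⟨p, hp⟩
    with hv
  have hres : v.residueCard = p := by
    rw [hv, Rat.residueCard_eq_natGenerator', Rat.natGenerator_primesEquiv_symm]
  obtain ⟨-, Q, hQ, hQeq⟩ := h v (by rw [hres]; exact hp1951) (by rw [hres]; exact hpℓ)
  rw [hres, splittingRHS_rat hp, Polynomial.map_sub, Polynomial.map_X, Polynomial.map_one] at hQeq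
  have hQ1 : Q = 1 := by
    have h1 : (X - C (1 : PadicAlgCl ℓ)) * Q = (X - C 1) * 1 := by rw [mul_one, hQeq, map_one]
    exact mul_left_cancel₀ (X_sub_C_ne_zero 1) h1
  -- a Frobenius exists at `v`; its characteristic polynomial has degree `4`, not `0`
  obtain ⟨𝔓, h𝔓⟩ := v.primesAbove_nonempty
  obtain ⟨σ, hσ⟩ := HeightOneSpectrum.exists_isArithFrobAt_of_mem_primesAbove_holds h𝔓
  have hc := hQ 𝔓 h𝔓 σ hσ
  rw [hQ1] at hc
  have hdeg := congrArg Polynomial.natDegree hc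
  rw [FramedRep.charpoly, Matrix.charpoly_natDegree_eq_dim] at hdeg
  simp at hdeg

end Summit.Langlands.Langlands.Theorems.DedekindQuotientEntire.Negative

end
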